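import Summits.AnomalousDissipation.AnomalousDissipation.Theorems.MomentParityResolvedDissipationInvariance
import Summits.AnomalousDissipation.AnomalousDissipation.Theorems.MomentParityResolvedDissipationReduction

/-!
# Stub `stub_certificateAveraging` for line `enstrophy-ui-level-ledger`
# (crux `MomentParity.ResolvedDissipation`, stmt-AnomalousDissipation-14284)

Weak duality of the Tobasco–Goluskin–Doering auxiliary-functional certificate for the crux's admissibility
class (stub S5 of the line). Write `Z(u) = ‖∇u‖² ∈ [0, ∞]` (`Torus.eGradNormSq` of the `L²` representative of
`u ∈ H`). For every `(f, ν > 0, R)` there is `B = B(f, ν, R) ≥ 0` — here `B = 2 (1 + ‖f‖₂ |R| / ν)` — such that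
for every ADMISSIBLE LAW `μ` at level `N` (probability, carried by level-`N` fields, supported in `‖u‖ ≤ R`,
polynomially stationary for Galerkin NS at `(ν, f)` at every degree), every band-limited cylindrical test
functional `Φ` and all reals `Λ, η`, the POINTWISE certificate on the carrier
`(Z(u) − Λ)₊ + ⟨F(u), Φ'(u)⟩ ≤ η (1 + Z(u))` forces the tail bound `∫_{Z > 2Λ} Z dμ ≤ B η`.

Proof (Tobasco–Goluskin–Doering 2018 §2, weak duality; FMRT 2001 Ch. IV §1.2):
* the row `u ↦ ⟨F(u), Φ'(u)⟩` is integrable with zero mean (`admissible_rows_cylindrical`: all-degree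
  polynomial stationarity upgrades to `C¹_c` profiles on the compact level ball);
* `Z ≤ 4π²N²R²` a.e. (Bernstein on level-`N` fields, `CubicParityLoud.Negative.eGradNormSq_le_of_isLevel`), so
  `Z.toReal` and the hinge `(Z.toReal − Λ)₊` are integrable; integrating the certificate gives
  `∫ (Z − Λ)₊ dμ ≤ η (1 + ∫ Z dμ)`;
* the `N`-uniform budget `∫ Z dμ ≤ ‖f‖₂ R / ν` (`ensembleEnstrophy_le_budget`, energy row + Cauchy–Schwarz);
* `Z > 2Λ ⟹ Z ≤ 2 (Z − Λ)₊` (any sign of `Λ`), so `∫⁻_{Z > 2Λ} Z dμ ≤ ofReal (2 ∫ (Z − Λ)₊ dμ) ≤ ofReal (B η)`;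
  a negative `η` contradicts `∫ (Z − Λ)₊ ≥ 0`.
-/

noncomputable section

-- `Summit.<Summit>.<Problem>`: single-conjunct summit, the duplicate namespace segment is mandated.
set_option linter.dupNamespace false

namespace Summit.AnomalousDissipation.AnomalousDissipation.Theorems.MomentParityResolvedDissipation.CertificateAveraging

open MeasureTheory Filter Topology
open scoped ENNReal InnerProductSpace RealInnerProductSpace
open Literature.Analysis.FunctionSpaces Literature.Analysis.FluidPDE
open Summit.AnomalousDissipation.AnomalousDissipation.Theses.MomentParity
open Summit.AnomalousDissipation.AnomalousDissipation.Theorems.CubicParityLoud.Negative (T3 R3 H3)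
open Summit.AnomalousDissipation.AnomalousDissipation.Theorems.QuarticGate.Negative
  (IsLevel IsBandTest polyGrad IsPolyStationary)

/-! ## Abstract measure theory: the tail integral is controlled by the hinge integral -/

/-- **Scalar step**: above the doubled level, the value is at most twice the hinge,
`2Λ < z ⟹ z ≤ 2 (z − Λ)₊` (both signs of `Λ`). [folklore] -/
theorem le_two_mul_hinge {z Λ : ℝ} (h : 2 * Λ < z) : z ≤ 2 * max (z - Λ) 0 := by
  have := le_max_left (z - Λ) 0
  linarith

/-- **Tail integral vs. hinge integral**: for a measurable, a.e. finite `Z : α → [0, ∞]` whose real hinge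
`(Z.toReal − Λ)₊` is integrable, `∫⁻_{Z > 2Λ} Z dμ ≤ ofReal (2 ∫ (Z.toReal − Λ)₊ dμ)` (pointwise
`Z ≤ ofReal (2 (Z.toReal − Λ)₊)` on the tail set, drop the restriction, Bochner ↔ lower integral for the
nonnegative integrable hinge). [folklore] -/
theorem setLIntegral_le_ofReal_two_mul_integral_hinge {α : Type*} [MeasurableSpace α] {μ : Measure α}
    {Z : α → ℝ≥0∞} (hZm : Measurable Z) (hZlt : ∀ᵐ x ∂μ, Z x < ⊤) (Λ : ℝ)
    (hg : Integrable (fun x => max ((Z x).toReal - Λ) 0) μ) :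
    ∫⁻ x in {x | ENNReal.ofReal (2 * Λ) < Z x}, Z x ∂μ ≤
      ENNReal.ofReal (2 * ∫ x, max ((Z x).toReal - Λ) 0 ∂μ) := by
  have hgm : Measurable fun x => ENNReal.ofReal (2 * max ((Z x).toReal - Λ) 0) :=
    (((hZm.ennreal_toReal.sub_const Λ).max measurable_const).const_mul 2).ennreal_ofReal
  calc ∫⁻ x in {x | ENNReal.ofReal (2 * Λ) < Z x}, Z x ∂μ
      ≤ ∫⁻ x in {x | ENNReal.ofReal (2 * Λ) < Z x}, ENNReal.ofReal (2 * max ((Z x).toReal - Λ) 0) ∂μ := by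
        refine setLIntegral_mono_ae hgm.aemeasurable ?_
        filter_upwards [hZlt] with x hx hxS
        obtain ⟨z, hz0, hz⟩ : ∃ z : ℝ, 0 ≤ z ∧ Z x = ENNReal.ofReal z :=
          ⟨(Z x).toReal, ENNReal.toReal_nonneg, (ENNReal.ofReal_toReal hx.ne).symm⟩
        rw [hz, ENNReal.ofReal_lt_ofReal_iff'] at hxS
        rw [hz, ENNReal.toReal_ofReal hz0]
        exact ENNReal.ofReal_le_ofReal (le_two_mul_hinge hxS.1)
    _ ≤ ∫⁻ x, ENNReal.ofReal (2 * max ((Z x).toReal - Λ) 0) ∂μ := setLIntegral_le_lintegral _ _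
    _ = ENNReal.ofReal (∫ x, 2 * max ((Z x).toReal - Λ) 0 ∂μ) :=
        (ofReal_integral_eq_lintegral_ofReal (hg.const_mul 2)
          (ae_of_all _ fun x => by simp only [Pi.zero_apply]; positivity)).symm
    _ = ENNReal.ofReal (2 * ∫ x, max ((Z x).toReal - Λ) 0 ∂μ) := by rw [integral_const_mul]

/-! ## The carrier: a.e. Bernstein bound, integrability of the enstrophy and of its hinge -/

/-- **Bernstein, a.e. on the carrier**: a law carried by level-`N` fields of the ball `‖u‖ ≤ R` has
`Z = ‖∇u‖² ≤ 4π²N²R²` almost everywhere (`CubicParityLoud.Negative.eGradNormSq_le_of_isLevel`). [folklore] -/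
theorem eGradNormSq_le_ae {N : ℕ} {R : ℝ} {μ : Measure H3} (hL : ∀ᵐ u ∂μ, IsLevel N u)
    (hB : ∀ᵐ u ∂μ, ‖u‖ ≤ R) :
    ∀ᵐ u ∂μ, Torus.eGradNormSq (u.1 : T3 → R3) ≤ ENNReal.ofReal (4 * Real.pi ^ 2 * (N : ℝ) ^ 2 * R ^ 2) := by
  filter_upwards [hL, hB] with u hu1 hu2
  refine (CubicParityLoud.Negative.eGradNormSq_le_of_isLevel hu1).trans (ENNReal.ofReal_le_ofReal ?_)
  exact mul_le_mul_of_nonneg_left (pow_le_pow_left₀ (norm_nonneg _) hu2 2) (by positivity)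

/-- The enstrophy is a.e. FINITE on a law carried by level-`N` fields of a ball. [folklore] -/
theorem eGradNormSq_lt_top_ae {N : ℕ} {R : ℝ} {μ : Measure H3} (hL : ∀ᵐ u ∂μ, IsLevel N u)
    (hB : ∀ᵐ u ∂μ, ‖u‖ ≤ R) : ∀ᵐ u ∂μ, Torus.eGradNormSq (u.1 : T3 → R3) < ⊤ :=
  (eGradNormSq_le_ae hL hB).mono fun _ hu => lt_of_le_of_lt hu ENNReal.ofReal_lt_top

/-- **Integrability of the real enstrophy** `u ↦ (‖∇u‖²).toReal` on a finite law carried by level-`N`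
fields of a ball (measurable — `Torus.measurable_eGradNormSq_coe` — and a.e. bounded by `4π²N²R²`).
[folklore] -/
theorem integrable_toReal_eGradNormSq {N : ℕ} {R : ℝ} {μ : Measure H3} [IsFiniteMeasure μ]
    (hL : ∀ᵐ u ∂μ, IsLevel N u) (hB : ∀ᵐ u ∂μ, ‖u‖ ≤ R) :
    Integrable (fun u : H3 => (Torus.eGradNormSq (u.1 : T3 → R3)).toReal) μ := by
  refine Integrable.of_bound Torus.measurable_eGradNormSq_coe.ennreal_toReal.aestronglyMeasurable
    (4 * Real.pi ^ 2 * (N : ℝ) ^ 2 * R ^ 2) ?_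
  filter_upwards [eGradNormSq_le_ae hL hB] with u hu
  rw [Real.norm_eq_abs, abs_of_nonneg ENNReal.toReal_nonneg]
  exact ENNReal.toReal_le_of_le_ofReal (by positivity) hu

/-- **Integrability of the enstrophy hinge** `u ↦ ((‖∇u‖²).toReal − Λ)₊` on a finite law carried by
level-`N` fields of a ball (measurable and a.e. bounded by `4π²N²R² + |Λ|`). [folklore] -/
theorem integrable_hinge {N : ℕ} {R : ℝ} {μ : Measure H3} [IsFiniteMeasure μ]
    (hL : ∀ᵐ u ∂μ, IsLevel N u) (hB : ∀ᵐ u ∂μ, ‖u‖ ≤ R) (Λ : ℝ) :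
    Integrable (fun u : H3 => max ((Torus.eGradNormSq (u.1 : T3 → R3)).toReal - Λ) 0) μ := by
  refine Integrable.of_bound
    ((Torus.measurable_eGradNormSq_coe.ennreal_toReal.sub_const Λ).max
      measurable_const).aestronglyMeasurable
    (4 * Real.pi ^ 2 * (N : ℝ) ^ 2 * R ^ 2 + |Λ|) ?_
  filter_upwards [eGradNormSq_le_ae hL hB] with u hu
  have hz : (Torus.eGradNormSq (u.1 : T3 → R3)).toReal ≤ 4 * Real.pi ^ 2 * (N : ℝ) ^ 2 * R ^ 2 :=
    ENNReal.toReal_le_of_le_ofReal (by positivity) hu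
  rw [Real.norm_eq_abs, abs_of_nonneg (le_max_right _ _)]
  refine max_le ?_ (by positivity)
  linarith [neg_le_abs Λ]

/-! ## Averaging the certificate -/

/-- **The certificate, averaged**: for an admissible law `μ` at level `N` (probability, level-`N` carrier,
ball `‖u‖ ≤ R`, polynomially stationary at every degree) and a band-limited cylindrical `Φ`, the pointwise
certificate `(Z − Λ)₊ + ⟨F(u), Φ'(u)⟩ ≤ η (1 + Z)` on the carrier integrates to
`∫ (Z − Λ)₊ dμ ≤ η (1 + ∫ Z dμ)`: the row `⟨F(u), Φ'(u)⟩` has zero mean (`admissible_rows_cylindrical`).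
[folklore] -/
theorem integral_hinge_le {ν : ℝ} {f : T3 → R3} (hf : Torus.IsSmooth f) {N : ℕ} {R : ℝ}
    {μ : Measure H3} [IsProbabilityMeasure μ] (hL : ∀ᵐ u ∂μ, IsLevel N u) (hB : ∀ᵐ u ∂μ, ‖u‖ ≤ R)
    (hS : ∀ d : ℕ, IsPolyStationary ν f N d μ) (Φ : Torus.CylindricalTest (Fin 3))
    (hΦ : ∀ i, IsBandTest N (Φ.g i)) {Λ η : ℝ}
    (hcert : ∀ u : H3, IsLevel N u → ‖u‖ ≤ R →
      max ((Torus.eGradNormSq (u.1 : T3 → R3)).toReal - Λ) 0 +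
          Torus.nsGeneratorPairing ν f u (Φ.grad u) ≤
        η * (1 + (Torus.eGradNormSq (u.1 : T3 → R3)).toReal)) :
    ∫ u, max ((Torus.eGradNormSq (u.1 : T3 → R3)).toReal - Λ) 0 ∂μ ≤
      η * (1 + ∫ u, (Torus.eGradNormSq (u.1 : T3 → R3)).toReal ∂μ) := by
  obtain ⟨hInt, hRow⟩ := admissible_rows_cylindrical hf hL hB hS Φ (fun i => (hΦ i).2.2.2)
  have hg := integrable_hinge hL hB Λ
  have hZ := integrable_toReal_eGradNormSq hL hB
  have hrhs : Integrable (fun u : H3 => η * (1 + (Torus.eGradNormSq (u.1 : T3 → R3)).toReal)) μ :=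
    ((integrable_const 1).add hZ).const_mul η
  have h1 : ∫ u, (max ((Torus.eGradNormSq (u.1 : T3 → R3)).toReal - Λ) 0 +
        Torus.nsGeneratorPairing ν f u (Φ.grad u)) ∂μ ≤
      ∫ u, η * (1 + (Torus.eGradNormSq (u.1 : T3 → R3)).toReal) ∂μ :=
    integral_mono_ae (hg.add hInt) hrhs (by
      filter_upwards [hL, hB] with u hu1 hu2 using hcert u hu1 hu2)
  have h2 : ∫ u, η * (1 + (Torus.eGradNormSq (u.1 : T3 → R3)).toReal) ∂μ =
      η * (1 + ∫ u, (Torus.eGradNormSq (u.1 : T3 → R3)).toReal ∂μ) := by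
    rw [integral_const_mul, integral_add (integrable_const _) hZ]
    simp
  rw [integral_add hg hInt, hRow, add_zero, h2] at h1
  exact h1

/-! ## The stub -/

/-- **S5 · `stub_certificateAveraging` (certificates bound invariant averages — weak duality for the
crux's admissibility class).** For every `(f, ν > 0, R)` there is `B = B(f, ν, R) ≥ 0`
(`B = 2 (1 + ‖f‖₂ |R| / ν)`) such that for every admissible law `μ` at level `N`, every band-limited
cylindrical `Φ` and all reals `Λ, η`: the pointwise certificate `(Z − Λ)₊ + ⟨F(u), Φ'(u)⟩ ≤ η (1 + Z)` on
the level-`N` fields of the ball `‖u‖ ≤ R` forces `∫⁻_{Z > 2Λ} Z dμ ≤ ofReal (B η)`. Proof: average the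
certificate (`integral_hinge_le`), bound `∫ Z dμ ≤ ‖f‖₂ R / ν` (`ensembleEnstrophy_le_budget`), and use
`Z > 2Λ ⟹ Z ≤ 2 (Z − Λ)₊` (`setLIntegral_le_ofReal_two_mul_integral_hinge`); `η < 0` is contradictory and
`R < 0` vacuous (Tobasco–Goluskin–Doering 2018 §2 (6)–(7); FMRT 2001 Ch. IV §1.2). [folklore] -/
theorem stub_certificateAveraging :
    ∀ f : T3 → R3, Torus.IsSmooth f → Torus.IsDivFree f → Torus.HasZeroMean f →
    ∀ ν : ℝ, 0 < ν → ∀ R : ℝ, ∃ B : ℝ, 0 ≤ B ∧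
      ∀ (N : ℕ) (μ : Measure H3), IsProbabilityMeasure μ →
      (∀ᵐ u ∂μ, IsLevel N u) → (∀ᵐ u ∂μ, ‖u‖ ≤ R) → (∀ d : ℕ, IsPolyStationary ν f N d μ) →
      ∀ Φ : Torus.CylindricalTest (Fin 3), (∀ i, IsBandTest N (Φ.g i)) →
      ∀ Λ η : ℝ,
        (∀ u : H3, IsLevel N u → ‖u‖ ≤ R →
          max ((Torus.eGradNormSq (u.1 : T3 → R3)).toReal - Λ) 0 +
              Torus.nsGeneratorPairing ν f u (Φ.grad u) ≤
            η * (1 + (Torus.eGradNormSq (u.1 : T3 → R3)).toReal)) →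
        ∫⁻ u in {u : H3 | ENNReal.ofReal (2 * Λ) < Torus.eGradNormSq (u.1 : T3 → R3)},
            Torus.eGradNormSq (u.1 : T3 → R3) ∂μ ≤ ENNReal.ofReal (B * η) := by
  intro f hf _ _ ν hν R
  refine ⟨2 * (1 + Real.sqrt (∫ x, ‖f x‖ ^ 2) * |R| / ν), by positivity, ?_⟩
  intro N μ hP hL hB hS Φ hΦ Λ η hcert
  -- the support radius is nonnegative (the law is a probability measure)
  haveI : (ae μ).NeBot := ae_neBot.2 (IsProbabilityMeasure.ne_zero μ)
  obtain ⟨u₀, hu₀⟩ := hB.exists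
  have hR : 0 ≤ R := (norm_nonneg _).trans hu₀
  rw [abs_of_nonneg hR]
  -- the `N`-uniform enstrophy budget, in `ℝ`
  have hbudget : ∫ u, (Torus.eGradNormSq (u.1 : T3 → R3)).toReal ∂μ ≤
      Real.sqrt (∫ x, ‖f x‖ ^ 2) * R / ν := by
    rw [integral_toReal Torus.measurable_eGradNormSq_coe.aemeasurable (eGradNormSq_lt_top_ae hL hB)]
    exact ENNReal.toReal_le_of_le_ofReal (by positivity)
      (ensembleEnstrophy_le_budget hν (hf.memLp 2) hP hL hB hS)
  -- the averaged certificate and the sign of `η`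
  have havg := integral_hinge_le hf hL hB hS Φ hΦ hcert
  have hg0 : 0 ≤ ∫ u, max ((Torus.eGradNormSq (u.1 : T3 → R3)).toReal - Λ) 0 ∂μ :=
    integral_nonneg fun u => le_max_right _ _
  have hZ0 : 0 ≤ ∫ u, (Torus.eGradNormSq (u.1 : T3 → R3)).toReal ∂μ :=
    integral_nonneg fun u => ENNReal.toReal_nonneg
  have hη : 0 ≤ η := by
    by_contra h
    have : η * (1 + ∫ u, (Torus.eGradNormSq (u.1 : T3 → R3)).toReal ∂μ) < 0 :=
      mul_neg_of_neg_of_pos (not_le.1 h) (by linarith)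
    linarith
  have hfin : ∫ u, max ((Torus.eGradNormSq (u.1 : T3 → R3)).toReal - Λ) 0 ∂μ ≤
      η * (1 + Real.sqrt (∫ x, ‖f x‖ ^ 2) * R / ν) :=
    havg.trans (mul_le_mul_of_nonneg_left (by linarith) hη)
  -- the tail is controlled by the hinge
  refine (setLIntegral_le_ofReal_two_mul_integral_hinge Torus.measurable_eGradNormSq_coe
    (eGradNormSq_lt_top_ae hL hB) Λ (integrable_hinge hL hB Λ)).trans (ENNReal.ofReal_le_ofReal ?_)
  nlinarith

end Summit.AnomalousDissipation.AnomalousDissipation.Theorems.MomentParityResolvedDissipation.CertificateAveraging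

end
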